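import Mathlib.Probability.Independence.Basic
import Mathlib.MeasureTheory.Integral.Bochner.SumMeasure
import HarnessLib

/-!
# The inverse-variance weighted average with ESTIMATED variances is biased — a four-point witness

Topic `Probability/Moments`; companion of `InverseVarianceWeighting.lean`, which proves that with
DETERMINISTIC weights the combination `Ī = (Σ I_j/σ_j²)/(Σ 1/σ_j²)` of unbiased estimates is unbiased.
VEGAS-type integrators use ESTIMATED variances `σ̂_j²`, computed from the same samples as `I_j`;
[cite: Lepage2021, §2.5]: "the weighted sum `Ī` only becomes unbiased when `N_ev` is sufficiently large
that non-Gaussian effects are negligible. The leading non-Gaussian effect is the correlation between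
fluctuations in `I_j` and `σ_j²` […]. It introduces a bias in the weighted average [that vanishes like `1/N_ev`]".

`exists_biased_invVarWeightedMean` is a minimal kernel-checked witness of that sentence: two
INDEPENDENT estimates `I_1, I_2`, each `0` or `2` with probability `1/2` (so `E I_j = 1`), each reporting the
variance estimate `σ̂_j² = 1` when `I_j = 0` and `σ̂_j² = 3` when `I_j = 2` (larger values come with larger
variance estimates, as for a Monte Carlo sum); then `E[(Σ I_j/σ̂_j²)/(Σ 1/σ̂_j²)] = 3/4 ≠ 1` — the
combination is pulled toward the estimates that CLAIM the smaller variance. Nothing quantitative about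
VEGAS is asserted; the point is only that unbiasedness of `Ī` is a property of deterministic weights
(true variances), not of the formula.

References: G. P. Lepage, J. Comput. Phys. 439 (2021) 110386, §2.5 (held text arXiv:2009.05112,
materialised page p0007). [Lepage2021]
-/

noncomputable section

open MeasureTheory ProbabilityTheory Finset
open scoped ENNReal

namespace Literature.Probability.Moments

namespace InvVarBiasWitness

/-- The fair coin as a measure on `Bool`: half the counting measure. [folklore] -/
def coin : Measure Bool := (2 : ℝ≥0∞)⁻¹ • Measure.count

/-- [folklore] -/
instance : IsProbabilityMeasure coin := by
  refine ⟨?_⟩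
  have h2 : (Measure.count : Measure Bool) Set.univ = 2 := by
    rw [Measure.count_univ]; norm_num
  rw [coin, Measure.smul_apply, smul_eq_mul, h2]
  exact ENNReal.inv_mul_cancel (by norm_num) (by norm_num)

/-- The two-coin sample space `Bool × Bool` with the product of two fair coins. [folklore] -/
def space : Measure (Bool × Bool) := coin.prod coin

/-- [folklore] -/
instance : IsProbabilityMeasure space := by
  unfold space; infer_instance

/-- An estimate: `2` on heads, `0` on tails (mean `1`). [folklore] -/
def est (b : Bool) : ℝ := if b then 2 else 0

/-- Its reported variance ESTIMATE: `3` on heads, `1` on tails (correlated with the estimate). [folklore] -/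
def varEst (b : Bool) : ℝ := if b then 3 else 1

/-- The two estimates `I_1 = est ∘ fst`, `I_2 = est ∘ snd`. [folklore] -/
def I : Fin 2 → Bool × Bool → ℝ := ![fun ω ↦ est ω.1, fun ω ↦ est ω.2]

/-- Their variance estimates `σ̂_1² = varEst ∘ fst`, `σ̂_2² = varEst ∘ snd`. [folklore] -/
def S : Fin 2 → Bool × Bool → ℝ := ![fun ω ↦ varEst ω.1, fun ω ↦ varEst ω.2]

/-- The inverse-variance weighted average with the ESTIMATED variances as weights. [folklore] -/
def ivw (ω : Bool × Bool) : ℝ := (∑ j, I j ω / S j ω) / ∑ j, (S j ω)⁻¹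

/-- Every outcome of the two-coin space has probability `1/4`. [folklore] -/
private theorem space_real_singleton (x : Bool × Bool) : space.real {x} = 4⁻¹ := by
  obtain ⟨a, b⟩ := x
  rw [measureReal_def, space, ← Set.singleton_prod_singleton, Measure.prod_prod]
  simp only [coin, Measure.smul_apply, smul_eq_mul, Measure.count_singleton, mul_one]
  rw [← ENNReal.mul_inv (Or.inl (by norm_num)) (Or.inl (by norm_num)), ENNReal.toReal_inv]
  norm_num

/-- Expectation on the two-coin space = the plain average over the four outcomes. [folklore] -/
private theorem integral_space (f : Bool × Bool → ℝ) :
    ∫ ω, f ω ∂space = 4⁻¹ * (f (false, false) + f (false, true) + f (true, false) + f (true, true)) := by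
  rw [integral_fintype (Integrable.of_finite), Fintype.sum_prod_type]
  simp only [space_real_singleton, smul_eq_mul, Fintype.sum_bool]
  ring

end InvVarBiasWitness

open InvVarBiasWitness in
/-- **Estimated-variance weights bias the inverse-variance average** [cite: Lepage2021, §2.5] ("The
leading non-Gaussian effect is the correlation between fluctuations in `I_j` and `σ_j²` […]. It
introduces a bias in the weighted average"): there are a probability space and two INDEPENDENT estimates `I_1, I_2`
with `E I_j = 1`, positive variance estimates `σ̂_j²`, such that `E[(Σ_j I_j/σ̂_j²)/(Σ_j 1/σ̂_j²)] = 3/4 ≠ 1`.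
Contrast `integral_weightedMean` (deterministic normalised weights ⇒ unbiased). -/
theorem exists_biased_invVarWeightedMean :
    ∃ (Ω : Type) (_ : MeasurableSpace Ω) (μ : Measure Ω) (I S : Fin 2 → Ω → ℝ),
      IsProbabilityMeasure μ ∧ IndepFun (I 0) (I 1) μ ∧ (∀ j, ∫ ω, I j ω ∂μ = 1) ∧
      (∀ j ω, 0 < S j ω) ∧
      ∫ ω, (∑ j, I j ω / S j ω) / (∑ j, (S j ω)⁻¹) ∂μ = 3 / 4 := by
  refine ⟨Bool × Bool, inferInstance, space, I, S, inferInstance, ?_, ?_, ?_, ?_⟩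
  · -- independence of the two coordinates under the product measure
    simpa [I, space] using
      (indepFun_prod (μ := coin) (ν := coin) (X := est) (Y := est) (by measurability) (by measurability))
  · intro j
    fin_cases j <;> simp [I, est, integral_space] <;> norm_num
  · refine Fin.forall_fin_two.mpr ⟨fun ω ↦ ?_, fun ω ↦ ?_⟩ <;>
      simp only [S, Matrix.cons_val_zero, Matrix.cons_val_one, varEst] <;> positivity
  · rw [integral_space]
    simp [Fin.sum_univ_two, I, S, est, varEst]
    norm_num

end Literature.Probability.Moments
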